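import Literature.Probability.Percolation.FiveArmShift
import Literature.Probability.Percolation.StoppingSetDecoupling
import HarnessLib

/-!
# The five-arm site of the lowest crossing, V: the event, and its probability by decoupling along the explored set

Topic `Literature/Probability/Percolation`; family `crit-perc`. PROOFS ONLY (no definition, no named
fact). Fifth brick of the separation-free proof of the two-radii five-arm lower bound (W. Werner,
PCMI 2009, Lecture 6, §3, and first exercise sheet, "Five-arm exponent", 3; P. Nolin, EJP 13
(2008), proof of Thm. 24 (ii) [arXiv 0711.4948: Thm. 23 (ii), p. 17]: "With probability at least
`δ₁₆² > 0`, there is a black horizontal crossing in the strip … together with a white one …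
condition on the lowest black left-right crossing `c` … the percolation in the region above it
remains unbiased. Now, still using RSW, with positive probability `c` is connected to the top side
by a black path included in `[-N/8,0] × [-N,N]`, and another white path included in
`[0,N/8] × [-N,N]`").

`real_fiveArmSite_ge` — in the parallelogram `R(M, N)` at any density `s`, the event "there is a
site `v` of the explored set of the lowest open crossing around every `r`-neighbour `z` of which
`ω - z` has three open and two closed arms from `∂Λ_{r+1}` to `∂Λ_R`, for all `r + 1 < R ≤ D - r`"
(the conclusion of `exists_forall_relabel_shift_mem_armEvent_five`, `FiveArmShift.lean`) has
probability at least
`P_s(LR(M, h₂)) · P_{1-s}(LR(M, h)) P_{1-s}(LR(h, M)) · P_s(LR(N, w₁)) · P_{1-s}(LR(N, w₂))`: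
an open crossing of the row strip `[0, M] × [h+1, h+1+h₂]` (whence the lowest open crossing and
the bound `h + h₂ + 1` on the height of the explored set, `explored_row_le`), a closed horizontal
and a closed vertical crossing of the bottom strip `[0, M] × [0, h]` (Harris; together a closed
left–right crossing inside the closed cluster of the bottom side), and — conditionally on the
explored data, by the stopping-set decoupling `mul_real_mem_dataEvent_le`
(`StoppingSetDecoupling.lean`; Nolin: "percolation there remains unbiased") — an open vertical
crossing of the column `[a₁, a₁+w₁] × [0, N]` and a closed one of `[a₂, a₂+w₂] × [0, N]` off the
explored set, two events determined by disjoint sets of unexplored sites (independence) and each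
implied by the full column crossing. All crossing probabilities are the tree's
`triLRCrossingProb` through `triSitePercolation_real_triHCross/triVCross`.

## References

* P. Nolin, Near-critical percolation in two dimensions, *Electron. J. Probab.* 13 (2008)
  1562–1623, §5.2, proof of Thm. 24 (ii) (arXiv 0711.4948: Thm. 23 (ii), p. 17) [Nolin2008].
* W. Werner, *Lectures on two-dimensional critical percolation*, IAS/Park City Math. Ser. 16
  (2009), Lecture 6, §3; first exercise sheet, "Five-arm exponent" [WernerPCMI2009].
* H. Kesten, Scaling relations for 2D-percolation, *Comm. Math. Phys.* 109 (1987), proof of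
  Lemma 2 (conditioning on the lowest crossing) [KestenScalingCMP1987].
* B. Bollobás, O. Riordan, *Percolation*, CUP (2006), Ch. 7, p. 175 (stopping sets)
  [BollobasRiordan2006].

## Mathlib / tree

Tree: `exists_forall_relabel_shift_mem_armEvent_five` (`FiveArmShift.lean`),
`mul_real_mem_dataEvent_le` (`StoppingSetDecoupling.lean`), `isStoppingSet_explored`,
`exists_lr_subset_explored`, `explored_subset`, `mem_explored`, `mem_botCluster`,
`bottomSide_subset_explored`, `botCluster_subset_explored` (`TriLowestCrossingSwitch.lean`),
`triHCross`, `triVCross`, `determinedBy_triHCross/triVCross`, `isUpperSet_triHCross/triVCross`,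
`triSitePercolation_real_triHCross/triVCross`, `determinedBy_compl_mem`, `pathIn_inter_congr`,
`PathIn.exists_support` (`TriRSWChaining.lean`), `sitePercolation_harris'`,
`sitePercolation_real_inter_of_disjoint` (`SitePercolationMeasure.lean`),
`sitePercolation_real_preimage_compl` (`TriHexLemma.lean`), `PathIn.tri_crossings_meet`
(`TriCrossingsMeet.lean`), `DeterminedBy.mono/inter`, `determinedBy_univ` (`PercolationEvents.lean`).
-/

noncomputable section

open Set MeasureTheory
open scoped unitInterval

namespace Literature.Probability.Percolation

open LatticeModels

variable {M N : ℕ} {ω : Set (Site 2)}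

/-! ### The height of the explored set below an open crossing -/

/-- **Below an open crossing of the row strip `[0, M] × [h+1, h+1+h₂]` the explored set has height
at most `h + h₂ + 1`**: a closed path from the bottom side reaching the row `h + 1 + h₂` would be a
bottom–top crossing of `[0, M] × [0, h+1+h₂]` meeting the open crossing
(`PathIn.tri_crossings_meet`); the explored set is the bottom side, that closed cluster and its
neighbours. [cite: KestenPTM1982, §2.2 (paths crossing a rectangle must intersect)] -/
theorem explored_row_le {h h₂ : ℕ} (hE : ω ∈ triHCross 0 (h + 1) M h₂)
    {e : Site 2} (he : e ∈ explored M N ω) : e 1 ≤ h + h₂ + 1 := by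
  have hbot : ∀ c ∈ botCluster M N ω, c 1 ≤ h + h₂ := by
    intro c hc
    by_contra hlt
    rw [not_le] at hlt
    obtain ⟨b, hb, hbc⟩ := mem_botCluster.1 hc
    have hb1 : b 1 = 0 := (mem_coe_bottomSide.1 (Finset.mem_coe.2 hb)).2
    set Rlow : Set (Site 2) := {z | z 1 < h + 1 + h₂} with hRlow
    have hbR : b ∈ Rlow := by show b 1 < h + 1 + h₂; rw [hb1]; omega
    have hcR : c ∉ Rlow := by show ¬ c 1 < h + 1 + h₂; omega
    obtain ⟨a, d, haR, hdR, hdA, had, hpa⟩ := hbc.exit hbR hcR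
    change a 1 < h + 1 + h₂ at haR
    change ¬ d 1 < h + 1 + h₂ at hdR
    have hcoord := triGraph_adj_coord had 1
    have hd1 : d 1 = ((h + 1 + h₂ : ℕ) : ℤ) := by push_cast; omega
    set A' : Set (Site 2) := {z | z ∈ (↑(rectangle M N) : Set (Site 2)) ∩ ωᶜ ∧ z 1 ≤ h + 1 + h₂}
      with hA'
    have hdA' : d ∈ A' := ⟨hdA, by rw [hd1]; push_cast; exact le_rfl⟩
    have hsub : Rlow ∩ (↑(rectangle M N) ∩ ωᶜ) ⊆ A' := fun z hz => ⟨hz.2, le_of_lt hz.1⟩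
    have hq : PathIn triGraph A' b d := (hpa.mono hsub).tail had hdA'
    obtain ⟨x, y, hx, hy, hπ⟩ := hE
    obtain ⟨z, hz, hz'⟩ := PathIn.tri_crossings_meet (L := 0) (R := M) (B := 0)
      (T := ((h + 1 + h₂ : ℕ) : ℤ)) (A := triStrip 0 (h + 1) M h₂ ∩ ω) (A' := A')
      (fun z hz => by obtain ⟨⟨h1, h2, h3, h4⟩, -⟩ := hz; push_cast at *; omega)
      (fun z hz => by
        obtain ⟨⟨hzR, -⟩, hz1⟩ := hz
        obtain ⟨h1, h2, h3, -⟩ := mem_coe_rectangle.1 hzR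
        push_cast at *; omega)
      hπ hx (by simpa using hy) hq hb1 hd1
    exact hz'.1.2 hz.2
  obtain ⟨heR, hcase⟩ := mem_explored.1 he
  rcases hcase with hb | ⟨u, hu, rfl | hue⟩
  · rw [(mem_coe_bottomSide.1 (Finset.mem_coe.2 hb)).2]; omega
  · have := hbot _ hu; omega
  · have := hbot _ hu
    have hc := triGraph_adj_coord hue 1
    omega

/-! ### A closed left–right crossing inside the closed cluster of the bottom side -/

/-- **A closed horizontal and a closed vertical crossing of the bottom strip give a closed
left–right crossing of `R(M, N)` inside the explored set** (they meet, so the horizontal one hangs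
from the bottom side inside the closed cluster of the bottom side). [cite: KestenPTM1982, §2.2–2.3] -/
theorem lrPathIn_explored_compl_of_closed_crossings {h : ℕ} (hhN : h ≤ N)
    (hH : ωᶜ ∈ triHCross 0 0 M h) (hV : ωᶜ ∈ triVCross 0 0 M h) :
    LRPathIn M N (↑(explored M N ω) ∩ ωᶜ) := by
  obtain ⟨x, y, hx, hy, hξ⟩ := hH
  obtain ⟨b, d, hb, hd, hζ⟩ := hV
  have hstripR : triStrip 0 0 M h ∩ ωᶜ ⊆ ↑(rectangle M N) ∩ ωᶜ := by
    rintro z ⟨⟨h1, h2, h3, h4⟩, hz⟩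
    exact ⟨Finset.mem_coe.2 (mem_rectangle_iff.2 ⟨h1, by omega, h3, by omega⟩), hz⟩
  obtain ⟨Sξ, hSξ, hξ', hallξ⟩ := hξ.exists_support
  obtain ⟨Sζ, hSζ, hζ', hallζ⟩ := hζ.exists_support
  have hbd : ∀ z ∈ triStrip 0 0 M h ∩ ωᶜ, (0 : ℤ) ≤ z 0 ∧ z 0 ≤ M ∧ (0 : ℤ) ≤ z 1 ∧ z 1 ≤ h := by
    rintro z ⟨⟨h1, h2, h3, h4⟩, -⟩; omega
  obtain ⟨z, hzξ, hzζ⟩ := PathIn.tri_crossings_meet (L := 0) (R := M) (B := 0) (T := h)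
    (fun z hz => hbd z (hSξ hz)) (fun z hz => hbd z (hSζ hz)) hξ' hx (by simpa using hy) hζ' hb
    (by simpa using hd)
  -- `b` lies on the bottom side, so every site of `ξ` is in the closed cluster of the bottom side
  have hbB : b ∈ bottomSide M N := by
    have hb' := (hSζ hζ'.left_mem).1
    rw [mem_triStrip] at hb'
    exact Finset.mem_filter.2 ⟨mem_rectangle_iff.2 ⟨hb'.1, by omega, by omega, by omega⟩, hb⟩
  have hbz : PathIn triGraph (↑(rectangle M N) ∩ ωᶜ) b z := (hallζ z hzζ).mono (hSζ.trans hstripR)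
  have hSξE : Sξ ⊆ ↑(explored M N ω) ∩ ωᶜ := by
    intro q hq
    have hzq : PathIn triGraph (↑(rectangle M N) ∩ ωᶜ) z q :=
      ((hallξ z hzξ).symm.trans (hallξ q hq)).mono (hSξ.trans hstripR)
    exact ⟨botCluster_subset_explored (mem_botCluster.2 ⟨b, hbB, hbz.trans hzq⟩), (hSξ hq).2⟩
  refine ⟨x, y, hx, by simpa using hy, hξ'.mono fun q hq => ⟨(hstripR (hSξ hq)).1, hSξE hq⟩⟩

/-! ### The probability of Nolin's five-arm configuration -/

/-- **The five-arm configuration has probability bounded below by five crossing probabilities**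
(Nolin 2008, proof of Thm. 24 (ii), arXiv p. 17; Werner 2009, first exercise sheet, "Five-arm
exponent", 3; the conditioning on the lowest crossing after Kesten 1987, proof of Lemma 2). In
`R(M, N)` with columns `[a₁, a₁+w₁]`, `[a₂, a₂+w₂]` (`2 ≤ a₁`, `a₁ + w₁ < a₂`, `a₂ + w₂ + 2 ≤ M`),
room `2D ≤ a₁ - 1`, `a₂ + w₂ + 1 + 2D ≤ M` and heights `h + h₂ + 1 + D ≤ N`, `h + h₂ + 2 ≤ N`, at
every density `s`:
`P_s(LR(M,h₂)) · (P_{1-s}(LR(M,h)) P_{1-s}(LR(h,M))) · (P_s(LR(N,w₁)) P_{1-s}(LR(N,w₂)))` is at most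
the `P_s`-probability that some explored site `v` has, around every centre `z` with `|v - z|_𝕋 ≤ r`
and for all `r + 1 < R ≤ D - r`, the five arms `ω - z ∈ armEvent ![T,T,T,F,F] (r+1) R`. See the
module docstring for the proof. [cite: Nolin2008, §5.2, proof of Thm. 24 (ii) (arXiv 0711.4948: Thm. 23 (ii), p. 17)] [cite: WernerPCMI2009, Lecture 2, first exercise sheet ("Five-arm exponent", 3))] [cite: KestenScalingCMP1987, proof of Lemma 2] -/
theorem real_fiveArmSite_ge (s : unitInterval) {M N h h₂ w₁ w₂ D : ℕ} {a₁ a₂ : ℤ}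
    (ha₁ : 2 ≤ a₁) (hw : a₁ + w₁ < a₂) (hb₂ : a₂ + w₂ + 2 ≤ (M : ℤ))
    (hDa : 2 * (D : ℤ) ≤ a₁ - 1) (hDb : a₂ + w₂ + 1 + 2 * (D : ℤ) ≤ M)
    (hN : h + h₂ + 1 + D ≤ N) (hN' : h + h₂ + 2 ≤ N) :
    triLRCrossingProb s M h₂ * (triLRCrossingProb (σ s) M h * triLRCrossingProb (σ s) h M) *
        (triLRCrossingProb s N w₁ * triLRCrossingProb (σ s) N w₂) ≤
      (triSitePercolation s).real {ω | ∃ v ∈ explored M N ω, ∀ (z : Site 2) (r R : ℕ),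
        triNorm (v - z) ≤ r → r + 1 < R → R + r ≤ D →
          SiteConfig.relabel (triShiftIso (-z)).toEquiv ω ∈
            armEvent ![true, true, true, false, false] (r + 1) R} := by
  classical
  /- the data-indexed events -/
  set good : Finset (Site 2) → Finset (Site 2) → Prop := fun F η =>
    bottomSide M N ⊆ F ∧ (∀ e ∈ F, e 1 ≤ h + h₂ + 1) ∧ LRPathIn M N (↑F ∩ ↑η) ∧ LRPathIn M N (↑F \ ↑η)
    with hgood
  set Col₁ : Set (Site 2) := triStrip a₁ 0 w₁ N with hCol₁
  set Col₂ : Set (Site 2) := triStrip a₂ 0 w₂ N with hCol₂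
  set A₁ : Finset (Site 2) → Set (Set (Site 2)) := fun F =>
    {ω | ∃ t ∈ topSide M N, ∃ g e : Site 2, e ∈ F ∧ triGraph.Adj g e ∧
      PathIn triGraph ((Col₁ \ ↑F) ∩ ω) t g} with hA₁
  set A₂ : Finset (Site 2) → Set (Set (Site 2)) := fun F =>
    {ω | ∃ t ∈ topSide M N, ∃ g e : Site 2, e ∈ F ∧ triGraph.Adj g e ∧
      PathIn triGraph ((Col₂ \ ↑F) ∩ ωᶜ) t g} with hA₂
  set Aev : Finset (Site 2) → Finset (Site 2) → Set (Set (Site 2)) := fun F η =>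
    if good F η then univ else ∅ with hAev
  set Bev : Finset (Site 2) → Finset (Site 2) → Set (Set (Site 2)) := fun F η =>
    if good F η then A₁ F ∩ A₂ F else ∅ with hBev
  set μ := sitePercolation (Site 2) s with hμ
  have hμt : triSitePercolation s = μ := rfl
  set c₁ : ℝ := triLRCrossingProb s N w₁ with hc₁
  set c₂ : ℝ := triLRCrossingProb (σ s) N w₂ with hc₂
  /- geometry of the columns -/
  have hCol₁R : Col₁ ⊆ ↑(rectangle M N) := by
    rintro z ⟨h1, h2, h3, h4⟩
    exact Finset.mem_coe.2 (mem_rectangle_iff.2 ⟨by omega, by omega, h3, by omega⟩)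
  have hCol₂R : Col₂ ⊆ ↑(rectangle M N) := by
    rintro z ⟨h1, h2, h3, h4⟩
    exact Finset.mem_coe.2 (mem_rectangle_iff.2 ⟨by omega, by omega, h3, by omega⟩)
  have hColF₁ : Col₁ = ↑(triStripFinset a₁ 0 w₁ N) := (coe_triStripFinset a₁ 0 w₁ N).symm
  have hColF₂ : Col₂ = ↑(triStripFinset a₂ 0 w₂ N) := (coe_triStripFinset a₂ 0 w₂ N).symm
  have hColdisj : Disjoint (triStripFinset a₁ 0 w₁ N) (triStripFinset a₂ 0 w₂ N) := by
    rw [← Finset.disjoint_coe, coe_triStripFinset, coe_triStripFinset, Set.disjoint_left]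
    rintro z ⟨-, h2, -⟩ ⟨h1, -⟩; omega
  /- determination of `A₁ F`, `A₂ F` by the unexplored sites of the columns -/
  have hdetA₁ : ∀ F, DeterminedBy (A₁ F) (Col₁ \ ↑F) := by
    intro F
    rw [determinedBy_iff]
    intro ω ω' hω
    constructor
    · rintro ⟨t, ht, g, e, he, hge, hp⟩; exact ⟨t, ht, g, e, he, hge, pathIn_inter_congr hω hp⟩
    · rintro ⟨t, ht, g, e, he, hge, hp⟩; exact ⟨t, ht, g, e, he, hge, pathIn_inter_congr hω.symm hp⟩
  have hdetA₂ : ∀ F, DeterminedBy (A₂ F) (Col₂ \ ↑F) := by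
    intro F
    rw [determinedBy_iff]
    have key : ∀ {ω ω' : Set (Site 2)}, ω ∩ (Col₂ \ ↑F) = ω' ∩ (Col₂ \ ↑F) →
        ωᶜ ∩ (Col₂ \ ↑F) = ω'ᶜ ∩ (Col₂ \ ↑F) := by
      intro ω ω' hω
      ext z
      have := Set.ext_iff.1 hω z
      simp only [mem_inter_iff, mem_compl_iff] at this ⊢
      tauto
    intro ω ω' hω
    constructor
    · rintro ⟨t, ht, g, e, he, hge, hp⟩; exact ⟨t, ht, g, e, he, hge, pathIn_inter_congr (key hω) hp⟩
    · rintro ⟨t, ht, g, e, he, hge, hp⟩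
      exact ⟨t, ht, g, e, he, hge, pathIn_inter_congr (key hω.symm) hp⟩
  /- the full column crossings imply `A₁ F`, `A₂ F` for good data -/
  have hfull₁ : ∀ F, bottomSide M N ⊆ F → (∀ e ∈ F, e 1 ≤ ((h + h₂ + 1 : ℕ) : ℤ)) →
      triVCross a₁ 0 w₁ N ⊆ A₁ F := by
    intro F hBF hHF ω ⟨b', t', hb', ht', hp⟩
    -- follow the crossing from the top down to its first site in `F`
    have hb'F : b' ∈ (↑F : Set (Site 2)) := by
      have hb'C := hp.left_mem.1
      rw [mem_triStrip] at hb'C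
      exact Finset.mem_coe.2 (hBF (Finset.mem_filter.2
        ⟨mem_rectangle_iff.2 ⟨by omega, by omega, by omega, by omega⟩, hb'⟩))
    have ht'C := hp.right_mem.1
    rw [mem_triStrip] at ht'C
    have ht'N : t' 1 = N := by omega
    have ht'F : t' ∉ (↑F : Set (Site 2)) := fun h' => by
      have := hHF t' (Finset.mem_coe.1 h'); push_cast at this; omega
    obtain ⟨g, e, -, heF, -, hge, hq⟩ := hp.symm.exit (R := (↑F : Set (Site 2))ᶜ) ht'F
      (fun h' => h' hb'F)
    have hsub : (↑F : Set (Site 2))ᶜ ∩ (Col₁ ∩ ω) ⊆ (Col₁ \ ↑F) ∩ ω :=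
      fun z hz => ⟨⟨hz.2.1, hz.1⟩, hz.2.2⟩
    refine ⟨t', ?_, g, e, not_not.1 heF, hge, hq.mono hsub⟩
    exact Finset.mem_filter.2 ⟨mem_rectangle_iff.2 ⟨by omega, by omega, by omega, by omega⟩, ht'N⟩
  have hfull₂ : ∀ F, bottomSide M N ⊆ F → (∀ e ∈ F, e 1 ≤ ((h + h₂ + 1 : ℕ) : ℤ)) →
      {ω : Set (Site 2) | ωᶜ ∈ triVCross a₂ 0 w₂ N} ⊆ A₂ F := by
    intro F hBF hHF ω ⟨b', t', hb', ht', hp⟩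
    have hb'F : b' ∈ (↑F : Set (Site 2)) := by
      have hb'C := hp.left_mem.1
      rw [mem_triStrip] at hb'C
      exact Finset.mem_coe.2 (hBF (Finset.mem_filter.2
        ⟨mem_rectangle_iff.2 ⟨by omega, by omega, by omega, by omega⟩, hb'⟩))
    have ht'C := hp.right_mem.1
    rw [mem_triStrip] at ht'C
    have ht'N : t' 1 = N := by omega
    have ht'F : t' ∉ (↑F : Set (Site 2)) := fun h' => by
      have := hHF t' (Finset.mem_coe.1 h'); push_cast at this; omega
    obtain ⟨g, e, -, heF, -, hge, hq⟩ := hp.symm.exit (R := (↑F : Set (Site 2))ᶜ) ht'F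
      (fun h' => h' hb'F)
    have hsub : (↑F : Set (Site 2))ᶜ ∩ (Col₂ ∩ ωᶜ) ⊆ (Col₂ \ ↑F) ∩ ωᶜ :=
      fun z hz => ⟨⟨hz.2.1, hz.1⟩, hz.2.2⟩
    refine ⟨t', ?_, g, e, not_not.1 heF, hge, hq.mono hsub⟩
    exact Finset.mem_filter.2 ⟨mem_rectangle_iff.2 ⟨by omega, by omega, by omega, by omega⟩, ht'N⟩
  /- the decoupling inequality -/
  have hdec : c₁ * c₂ * μ.real {ω | ω ∈ Aev (explored M N ω) ((explored M N ω).filter (· ∈ ω))} ≤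
      μ.real {ω | ω ∈ Bev (explored M N ω) ((explored M N ω).filter (· ∈ ω))} := by
    refine mul_real_mem_dataEvent_le s (G := rectangle M N) (isStoppingSet_explored M N)
      (fun ω => explored_subset ω) Aev Bev ?_ ?_ ?_
    · intro F η
      refine ⟨∅, Finset.disjoint_empty_right _, ?_⟩
      simp only [hAev]
      split_ifs
      · exact determinedBy_univ _
      · rw [determinedBy_iff]; intro ω ω' _; simp
    · intro F η
      refine ⟨(triStripFinset a₁ 0 w₁ N ∪ triStripFinset a₂ 0 w₂ N) \ F, Finset.disjoint_sdiff, ?_⟩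
      simp only [hBev]
      split_ifs
      · refine ((hdetA₁ F).mono ?_).inter ((hdetA₂ F).mono ?_)
        · intro z hz
          rw [Finset.coe_sdiff, Finset.coe_union, ← hColF₁, ← hColF₂]
          exact ⟨Or.inl hz.1, hz.2⟩
        · intro z hz
          rw [Finset.coe_sdiff, Finset.coe_union, ← hColF₁, ← hColF₂]
          exact ⟨Or.inr hz.1, hz.2⟩
      · rw [determinedBy_iff]; intro ω ω' _; simp
    · intro F η
      simp only [hAev, hBev]
      split_ifs with hg
      · obtain ⟨hBF, hHF, -, -⟩ := hg
        have hHF' : ∀ e ∈ F, e 1 ≤ ((h + h₂ + 1 : ℕ) : ℤ) := fun e he => by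
          have := hHF e he; push_cast; omega
        have hind : μ.real (A₁ F ∩ A₂ F) = μ.real (A₁ F) * μ.real (A₂ F) := by
          refine sitePercolation_real_inter_of_disjoint s
            (F := triStripFinset a₁ 0 w₁ N \ F) (G := triStripFinset a₂ 0 w₂ N \ F)
            ((hdetA₁ F).mono ?_) ((hdetA₂ F).mono ?_) ?_
          · intro z hz; rw [Finset.coe_sdiff, ← hColF₁]; exact hz
          · intro z hz; rw [Finset.coe_sdiff, ← hColF₂]; exact hz
          · exact Finset.disjoint_of_subset_left Finset.sdiff_subset
              (Finset.disjoint_of_subset_right Finset.sdiff_subset hColdisj)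
        have h1 : c₁ ≤ μ.real (A₁ F) := by
          rw [hc₁, ← triSitePercolation_real_triVCross s a₁ 0 w₁ N, hμt]
          exact measureReal_mono (hfull₁ F hBF hHF') (measure_ne_top _ _)
        have h2 : c₂ ≤ μ.real (A₂ F) := by
          rw [hc₂, ← triSitePercolation_real_triVCross (σ s) a₂ 0 w₂ N]
          have : (triSitePercolation (σ s)).real (triVCross a₂ 0 w₂ N) =
              μ.real {ω : Set (Site 2) | ωᶜ ∈ triVCross a₂ 0 w₂ N} := by
            show (sitePercolation (Site 2) (σ s)).real _ = _
            rw [hμ, ← sitePercolation_real_preimage_compl]; rfl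
          rw [this]
          exact measureReal_mono (hfull₂ F hBF hHF') (measure_ne_top _ _)
        rw [probReal_univ, mul_one, hind]
        exact mul_le_mul h1 h2 (by rw [hc₂]; exact measureReal_nonneg) measureReal_nonneg
      · simp
  /- the good data contain an independent pair of crossing events -/
  set E₂ : Set (Set (Site 2)) := triHCross 0 (h + 1) M h₂ with hE₂
  set F₀ : Set (Set (Site 2)) :=
    {ω | ωᶜ ∈ triHCross 0 0 M h} ∩ {ω | ωᶜ ∈ triVCross 0 0 M h} with hF₀
  have hsubgood : E₂ ∩ F₀ ⊆ {ω | ω ∈ Aev (explored M N ω) ((explored M N ω).filter (· ∈ ω))} := by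
    rintro ω ⟨hE, hH0, hV0⟩
    have hg : good (explored M N ω) ((explored M N ω).filter (· ∈ ω)) := by
      refine ⟨bottomSide_subset_explored ω, fun e he => ?_, ?_, ?_⟩
      · have := explored_row_le hE he; omega
      · -- the lowest open crossing
        have hLR : LRPathIn M N ω := by
          obtain ⟨x, y, hx, hy, hp⟩ := hE
          refine ⟨x, y, hx, by simpa using hy, hp.mono ?_⟩
          rintro z ⟨⟨h1, h2, h3, h4⟩, hz⟩
          exact ⟨Finset.mem_coe.2 (mem_rectangle_iff.2 ⟨h1, by omega, by omega, by omega⟩), hz⟩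
        refine (exists_lr_subset_explored hLR).mono ?_
        rintro z ⟨-, hzω, hzE⟩
        exact ⟨hzE, Finset.mem_coe.2 (Finset.mem_filter.2 ⟨Finset.mem_coe.1 hzE, hzω⟩)⟩
      · refine (lrPathIn_explored_compl_of_closed_crossings (by omega) hH0 hV0).mono ?_
        rintro z ⟨-, hzE, hzω⟩
        exact ⟨hzE, fun hzη => hzω (Finset.mem_filter.1 (Finset.mem_coe.1 hzη)).2⟩
    show ω ∈ Aev (explored M N ω) ((explored M N ω).filter (· ∈ ω))
    simp only [hAev, hg, if_true, mem_univ]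
  have hE₂F₀ : μ.real (E₂ ∩ F₀) = μ.real E₂ * μ.real F₀ := by
    refine sitePercolation_real_inter_of_disjoint s (F := triStripFinset 0 (h + 1) M h₂)
      (G := triStripFinset 0 0 M h) (determinedBy_triHCross 0 (h + 1) M h₂)
      ((determinedBy_compl_mem (determinedBy_triHCross 0 0 M h)).inter
        (determinedBy_compl_mem (determinedBy_triVCross 0 0 M h))) ?_
    rw [← Finset.disjoint_coe, coe_triStripFinset, coe_triStripFinset, Set.disjoint_left]
    rintro z ⟨-, -, h3, -⟩ ⟨-, -, -, h4⟩; omega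
  have hE₂val : μ.real E₂ = triLRCrossingProb s M h₂ := by
    rw [hE₂, ← hμt]; exact triSitePercolation_real_triHCross s 0 (h + 1) M h₂
  have hF₀val : triLRCrossingProb (σ s) M h * triLRCrossingProb (σ s) h M ≤ μ.real F₀ := by
    have : μ.real F₀ = (triSitePercolation (σ s)).real (triHCross 0 0 M h ∩ triVCross 0 0 M h) := by
      show _ = (sitePercolation (Site 2) (σ s)).real _
      rw [hμ, ← sitePercolation_real_preimage_compl]; rfl
    rw [this, ← triSitePercolation_real_triHCross (σ s) 0 0 M h,
      ← triSitePercolation_real_triVCross (σ s) 0 0 M h]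
    exact sitePercolation_harris' (σ s) (determinedBy_triHCross 0 0 M h)
      (determinedBy_triVCross 0 0 M h) (isUpperSet_triHCross 0 0 M h) (isUpperSet_triVCross 0 0 M h)
  /- the event of the right-hand side implies the five arms -/
  have hsubarm : {ω | ω ∈ Bev (explored M N ω) ((explored M N ω).filter (· ∈ ω))} ⊆
      {ω | ∃ v ∈ explored M N ω, ∀ (z : Site 2) (r R : ℕ),
        triNorm (v - z) ≤ r → r + 1 < R → R + r ≤ D →
          SiteConfig.relabel (triShiftIso (-z)).toEquiv ω ∈
            armEvent ![true, true, true, false, false] (r + 1) R} := by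
    intro ω hω
    change ω ∈ Bev (explored M N ω) ((explored M N ω).filter (· ∈ ω)) at hω
    simp only [hBev] at hω
    split_ifs at hω with hg
    · obtain ⟨⟨t₁, ht₁, g₁, e₁, he₁, hge₁, hp₁⟩, ⟨t₂, ht₂, g₂, e₂, he₂, hge₂, hp₂⟩⟩ := hω
      obtain ⟨-, hHF, hLRo, hLRc⟩ := hg
      have hg₁ := hp₁.right_mem.1.1
      have hg₂ := hp₂.right_mem.1.1
      rw [hCol₁, mem_triStrip] at hg₁
      rw [hCol₂, mem_triStrip] at hg₂
      refine exists_forall_relabel_shift_mem_armEvent_five (a₁ := a₁) (b₁ := a₁ + w₁) (a₂ := a₂)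
        (b₂ := a₂ + w₂) (D := D) ha₁ (by omega) (by omega) (by omega) (by omega)
        (by rw [min_eq_left (by omega)]; omega) (by rw [max_eq_right (by omega)]; omega)
        (fun e he => by have := hHF e he; omega) ?_ ?_ ?_ ?_ ?_
      · exact hLRo.mono fun z hz => (Finset.mem_filter.1 (Finset.mem_coe.1 hz.2.2)).2
      · refine hLRc.mono fun z hz hzω => ?_
        exact hz.2.2 (Finset.mem_coe.2 (Finset.mem_filter.2 ⟨Finset.mem_coe.1 hz.2.1, hzω⟩))
      · intro t ht htE
        have := hHF t htE
        rw [(mem_coe_topSide.1 (Finset.mem_coe.2 ht)).2] at this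
        omega
      · have hsub : (Col₁ \ ↑(explored M N ω)) ∩ ω ⊆ (↑(rectangle M N) \ ↑(explored M N ω)) ∩ ω :=
          fun z hz => ⟨⟨hCol₁R hz.1.1, hz.1.2⟩, hz.2⟩
        exact ⟨t₁, ht₁, g₁, e₁, he₁, hge₁, ⟨hg₁.1, hg₁.2.1⟩, hp₁.mono hsub⟩
      · have hsub : (Col₂ \ ↑(explored M N ω)) ∩ ωᶜ ⊆ (↑(rectangle M N) \ ↑(explored M N ω)) ∩ ωᶜ :=
          fun z hz => ⟨⟨hCol₂R hz.1.1, hz.1.2⟩, hz.2⟩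
        exact ⟨t₂, ht₂, g₂, e₂, he₂, hge₂, ⟨hg₂.1, hg₂.2.1⟩, hp₂.mono hsub⟩
    · simp at hω
  /- assembly -/
  have hc₁0 : 0 ≤ c₁ := by rw [hc₁]; exact measureReal_nonneg
  have hc₂0 : 0 ≤ c₂ := by rw [hc₂]; exact measureReal_nonneg
  calc triLRCrossingProb s M h₂ * (triLRCrossingProb (σ s) M h * triLRCrossingProb (σ s) h M) *
        (c₁ * c₂)
      ≤ μ.real E₂ * μ.real F₀ * (c₁ * c₂) := by
        rw [hE₂val]
        exact mul_le_mul_of_nonneg_right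
          (mul_le_mul_of_nonneg_left hF₀val measureReal_nonneg) (mul_nonneg hc₁0 hc₂0)
    _ = c₁ * c₂ * μ.real (E₂ ∩ F₀) := by rw [hE₂F₀]; ring
    _ ≤ c₁ * c₂ * μ.real {ω | ω ∈ Aev (explored M N ω) ((explored M N ω).filter (· ∈ ω))} :=
        mul_le_mul_of_nonneg_left (measureReal_mono hsubgood (measure_ne_top _ _))
          (mul_nonneg hc₁0 hc₂0)
    _ ≤ μ.real {ω | ω ∈ Bev (explored M N ω) ((explored M N ω).filter (· ∈ ω))} := hdec
    _ ≤ _ := by rw [hμt]; exact measureReal_mono hsubarm (measure_ne_top _ _)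

end Literature.Probability.Percolation
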